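import Summits.QuantumFields.YangMills.Theorems.SwapVirialDeficitZeroModeExactPairLaplace
import Summits.QuantumFields.YangMills.Theorems.SwapVirialDeficitZeroModeGroupThreeLaplaceRateHub
import HarnessLib

/-!
# Zero-mode EXACT rung Z3-L with a POWER RATE: `0 ≤ 1/2 − β·∫∫ e^{−β‖[q₁,q₂]‖²} dHaar² ≤ K·β^{−11/24}`
# (free-hands support of ⟨stmt-QuantumFields-24197⟩; the rate companion of w3 g62's ✓`ZeroModeExact.tendsto_pair_laplace`)

By ✓`mul_pairLaplace_eq` (w3 g62), `β·Λ₂(β) = ∫ ψ_β(‖Im q a‖²) dHaar(a)` with `ψ_β(σ) = (1 − e^{−4βσ})/(4σ)`, and by ✓`lintegral_haar_profile`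
`∫ 1/(4‖Im q a‖²) dHaar = 1/2`.  Hence the DEFICIT is EXACT: `1/2 − β·Λ₂(β) = ∫ e^{−4β‖Im q a‖²}/(4‖Im q a‖²) dHaar(a)` (`∼ 1/(4√(πβ))`).
With `e^{−x} ≤ x^{−p}` (`0 < p ≤ 1`, from ✓`ZeroModeGroup.rpow_mul_exp_neg_le`) the deficit is `≤ 4^{−(1+p)}β^{−p}·∫ (‖Im q a‖²)^{−(1+p)} dHaar`,
and the last moment is finite for `1 + p < 3/2` by the cone model (✓`ToronLog.measurePreserving_quatToSU2`: `‖Im q(x̂)‖² = ‖Im x‖²/‖x‖² ≥ ‖Im x‖²`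
on the unit ball) and ✓`ZeroModeGroup.lintegral_cone_hub_rpow_lt_top` (part IX of the `k = 3` rate).  We take `p = 11/24`:
* §1 `exp_neg_le_rpow_neg`, the pointwise split `1/(4σ) = ψ_β(σ) + e^{−4βσ}/(4σ)` and the bound `e^{−4βσ}/(4σ) ≤ β^{−p}·4^{−(1+p)}σ^{−(1+p)}`;
* §2 ★ `lintegral_haar_sqNormIm_rpow_lt_top` — `∫ (‖Im q a‖²)^{−35/24} dHaar < ∞`;
* §3 ★★ `half_le_mul_pairLaplace_add` (ENNReal) and ★★★ `abs_pair_laplace_sub_half_le` — `|β·Λ₂(β) − 1/2| ≤ K·β^{−11/24}` for every `β > 0`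
  (true rate `β^{−1/2}`; the exponent is limited only by the moment `E[(‖Im q‖²)^{−3/2+}] = ∞`).
HONEST LABEL: exact finite-dimensional Haar asymptotics (plan-level zero-mode rung of a DRAFT line «sharp-sigma»); NOT the fixed-`L` sharp law, NOT ⟨24197⟩;
the Yang–Mills mass gap is NOT proved; no summit is proved by a line.  Width seat ym-line-sfw-p2-w2 g56 (cell ym-idea-1, free hands; own crux ⟨22884⟩
blocked-on ⟨19935⟩), `--supports stmt-QuantumFields-24197`.  THEOREMS ONLY, standard axioms, 0 `sorry`.
References: [cite: Chatterjee2026YMHiggs, Lemma 5.1 / Cor. 5.2]; [cite: GonzalezarroyoAltes1988]; [folklore].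
-/

set_option autoImplicit false

noncomputable section

open MeasureTheory Quaternion Set Real Filter
open scoped Quaternion ENNReal BigOperators Topology
open Literature.MathematicalPhysics.QuantumLattice
open Literature.MathematicalPhysics.QuantumFieldTheory (haarProbability)
open Literature.MathematicalPhysics.QuantumFieldTheory.Balaban1983to89.T4HaarSU2Translate (su2Quat_quatToSU2 measurable_su2Quat continuous_su2Quat)
open Summit.QuantumFields.YangMills.Theorems.SwapTwistDeficit.ToronLog
open Summit.QuantumFields.YangMills.Theorems.SwapVirialDeficit.ZeroModeGroup (rpow_mul_exp_neg_le lintegral_cone_hub_rpow_lt_top ae_cone_imJ_ne_zero)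

attribute [local instance] Literature.Analysis.FluidPDE.Tao2016.quatMeasurableSpace
  Literature.Analysis.FluidPDE.Tao2016.quatBorelSpace
  Literature.MathematicalPhysics.QuantumLattice.secondCountableTopology_su2

namespace Summit.QuantumFields.YangMills.Theorems.SwapVirialDeficit.ZeroModeExact

/-! ## §1 Pointwise: the exact deficit and its power bound -/

/-- `e^{−x} ≤ x^{−p}` for `x > 0`, `0 < p ≤ 1`. [folklore] -/
theorem exp_neg_le_rpow_neg {x p : ℝ} (hx : 0 < x) (hp : 0 < p) (hp1 : p ≤ 1) : Real.exp (-x) ≤ x ^ (-p) := by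
  have h := rpow_mul_exp_neg_le (t := x) (c := 1) hx.le one_pos hp
  rw [one_mul, div_one] at h
  have hp' : p ^ p ≤ 1 := Real.rpow_le_one hp.le hp1 hp.le
  have hxp : 0 < x ^ p := Real.rpow_pos_of_pos hx p
  rw [Real.rpow_neg hx.le, ← one_div, le_div_iff₀ hxp, mul_comm]
  linarith

/-- The exact split of the limit profile: `1/(4σ) = ψ_β(σ) + e^{−4βσ}/(4σ)`. [folklore] -/
theorem inv_four_mul_eq_psi_add (β σ : ℝ) :
    1 / (4 * σ) = (1 - Real.exp (-(4 * β * σ))) / (4 * σ) + Real.exp (-(4 * β * σ)) / (4 * σ) := by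
  rw [← add_div]; ring_nf

/-- ★ The deficit profile has a power bound: `e^{−4βσ}/(4σ) ≤ β^{−p}·(4^{−(1+p)}·σ^{−(1+p)})` (`σ, β > 0`, `0 < p ≤ 1`). [folklore] -/
theorem exp_div_le_rpow {β σ p : ℝ} (hβ : 0 < β) (hσ : 0 < σ) (hp : 0 < p) (hp1 : p ≤ 1) :
    Real.exp (-(4 * β * σ)) / (4 * σ) ≤ β ^ (-p) * ((4:ℝ) ^ (-(1 + p)) * σ ^ (-(1 + p))) := by
  have hx : 0 < 4 * β * σ := by positivity
  have e : β ^ (-p) * ((4:ℝ) ^ (-(1 + p)) * σ ^ (-(1 + p))) = (4 * β * σ) ^ (-p) / (4 * σ) := by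
    rw [Real.mul_rpow (by positivity) hσ.le, Real.mul_rpow (by norm_num) hβ.le, neg_add, Real.rpow_add (by norm_num : (0:ℝ) < 4),
      Real.rpow_add hσ, Real.rpow_neg_one, Real.rpow_neg_one]
    field_simp
  rw [e]
  exact div_le_div_of_nonneg_right (exp_neg_le_rpow_neg hx hp hp1) (by positivity)

/-! ## §2 The negative moment `∫ (‖Im q a‖²)^{−γ} dHaar < ∞` for `γ < 3/2` -/

/-- In the cone model the imaginary part only grows: `(‖Im q(x̂)‖²)^{−γ} ≤ (‖Im x‖²)^{−γ}` for `0 < ‖x‖ < 1`, `Im x ≠ 0`, `γ ≥ 0`. [folklore] -/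
theorem rpow_sqNormIm_quatToSU2_le {x : ℍ} (hx : x ∈ Metric.ball (0:ℍ) 1) (him : x.im ≠ 0) {γ : ℝ} (hγ : 0 ≤ γ) :
    (‖(su2Quat (quatToSU2 x)).im‖ ^ 2) ^ (-γ) ≤ (‖x.im‖ ^ 2) ^ (-γ) := by
  have hx0 : x ≠ 0 := fun h => him (by rw [h]; rfl)
  have hn : 0 < ‖x‖ := norm_pos_iff.2 hx0
  have hn1 : ‖x‖ < 1 := by rwa [Metric.mem_ball, dist_zero_right] at hx
  have hi : 0 < ‖x.im‖ := norm_pos_iff.2 him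
  rw [su2Quat_quatToSU2 hx0, Quaternion.im_smul, norm_smul, Real.norm_eq_abs, abs_of_pos (inv_pos.2 hn)]
  refine Real.rpow_le_rpow_of_nonpos (by positivity) ?_ (by linarith)
  rw [mul_pow, inv_pow]
  have h1 : 1 ≤ (‖x‖ ^ 2)⁻¹ := one_le_inv_iff₀.2 ⟨by positivity, by nlinarith⟩
  nlinarith [sq_nonneg ‖x.im‖, mul_le_mul_of_nonneg_right h1 (sq_nonneg ‖x.im‖)]

/-- ★ **Negative moment**: `∫ (‖Im q a‖²)^{−γ} dHaar(a) < ∞` for `0 < γ`, `2γ/3 < 1` (here used at `γ = 35/24`). [folklore] -/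
theorem lintegral_haar_sqNormIm_rpow_lt_top {γ : ℝ} (hγ0 : 0 < γ) (hγ : 2 * (γ / 3) < 1) :
    ∫⁻ a, ENNReal.ofReal ((‖(su2Quat a).im‖ ^ 2) ^ (-γ)) ∂(haarProbability (Matrix.specialUnitaryGroup (Fin 2) ℂ)) < ∞ := by
  have hg : Measurable fun a : Matrix.specialUnitaryGroup (Fin 2) ℂ => ENNReal.ofReal ((‖(su2Quat a).im‖ ^ 2) ^ (-γ)) :=
    ENNReal.measurable_ofReal.comp ((((Quaternion.continuous_im.comp continuous_su2Quat).norm).pow 2 |>.measurable).pow_const _)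
  rw [← measurePreserving_quatToSU2.lintegral_comp hg]
  have hball : ∀ᵐ x ∂coneMeasure, x ∈ Metric.ball (0:ℍ) 1 := by
    unfold coneMeasure; exact Measure.ae_smul_measure (ae_restrict_mem measurableSet_ball) _
  refine lt_of_le_of_lt (lintegral_mono_ae ?_) (lintegral_cone_hub_rpow_lt_top hγ0 hγ)
  filter_upwards [hball, ae_cone_imJ_ne_zero] with x hx hJ
  have him : x.im ≠ 0 := fun h => hJ (by
    have : (x.im).imJ = 0 := by rw [h]; rfl
    simpa using this)
  exact ENNReal.ofReal_le_ofReal (rpow_sqNormIm_quatToSU2_le hx him hγ0.le)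

/-! ## §3 The rate -/

/-- ★★ **THE DEFICIT BOUND** (ENNReal): `1/2 ≤ β·Λ₂(β) + β^{−p}·4^{−(1+p)}·∫ (‖Im q a‖²)^{−(1+p)} dHaar` (`β > 0`, `0 < p ≤ 1`). [folklore] -/
theorem half_le_mul_pairLaplace_add {β p : ℝ} (hβ : 0 < β) (hp : 0 < p) (hp1 : p ≤ 1) :
    ENNReal.ofReal (1 / 2) ≤
      ENNReal.ofReal β * (∫⁻ q, ENNReal.ofReal (Real.exp (-(β * ‖su2Quat q.1 * su2Quat q.2 - su2Quat q.2 * su2Quat q.1‖ ^ 2)))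
        ∂((haarProbability (Matrix.specialUnitaryGroup (Fin 2) ℂ)).prod (haarProbability (Matrix.specialUnitaryGroup (Fin 2) ℂ)))) +
      ENNReal.ofReal (β ^ (-p) * (4:ℝ) ^ (-(1 + p))) *
        ∫⁻ a, ENNReal.ofReal ((‖(su2Quat a).im‖ ^ 2) ^ (-(1 + p))) ∂(haarProbability (Matrix.specialUnitaryGroup (Fin 2) ℂ)) := by
  rw [mul_pairLaplace_eq hβ, show (1 / 2 : ℝ) = 1 ^ 2 / 2 by norm_num, ← lintegral_haar_profile 1]
  have hm : Measurable fun a : Matrix.specialUnitaryGroup (Fin 2) ℂ => ENNReal.ofReal ((‖(su2Quat a).im‖ ^ 2) ^ (-(1 + p))) :=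
    ENNReal.measurable_ofReal.comp ((((Quaternion.continuous_im.comp continuous_su2Quat).norm).pow 2 |>.measurable).pow_const _)
  have hm2 : Measurable fun a : Matrix.specialUnitaryGroup (Fin 2) ℂ =>
      ENNReal.ofReal ((1 - Real.exp (-(4 * β * ‖(su2Quat a).im‖ ^ 2))) / (4 * ‖(su2Quat a).im‖ ^ 2)) := by
    have hc : Continuous fun a : Matrix.specialUnitaryGroup (Fin 2) ℂ => ‖(su2Quat a).im‖ ^ 2 :=
      ((Quaternion.continuous_im.comp continuous_su2Quat).norm).pow 2
    exact ENNReal.measurable_ofReal.comp ((((continuous_const.sub (Real.continuous_exp.comp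
      ((continuous_const.mul hc).neg))).measurable).div (hc.measurable.const_mul 4)))
  rw [← lintegral_const_mul _ hm, ← lintegral_add_left hm2]
  have hae : ∀ᵐ a ∂(haarProbability (Matrix.specialUnitaryGroup (Fin 2) ℂ)), (su2Quat a).im ≠ 0 :=
    ae_iff.2 (by simpa using haar_im_eq_zero_null)
  refine lintegral_mono_ae (hae.mono fun a ha => ?_)
  have hs : 0 < ‖(su2Quat a).im‖ ^ 2 := by have := norm_pos_iff.2 ha; positivity
  rw [one_pow, inv_four_mul_eq_psi_add β, ← ENNReal.ofReal_mul (by positivity)]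
  refine (ENNReal.ofReal_add_le).trans (add_le_add le_rfl (ENNReal.ofReal_le_ofReal ?_))
  have h := exp_div_le_rpow hβ hs hp hp1
  linarith [h]

/-- ★★★ **THE PAIR LAPLACE LAW WITH A POWER RATE**: for every `β > 0`,
`|β·∫∫ e^{−β‖q₁q₂ − q₂q₁‖²} dHaar² − 1/2| ≤ K·β^{−11/24}`, `K = 4^{−35/24}·(∫ (‖Im q a‖²)^{−35/24} dHaar).toReal` (the deficit is nonnegative by
✓`pair_laplace_le` and EXACTLY `∫ e^{−4β‖Im q a‖²}/(4‖Im q a‖²) dHaar ∼ 1/(4√(πβ))`; the exponent `11/24` is not optimal).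
HONEST LABEL: plan-level zero-mode rung; NOT ⟨24197⟩; the Yang–Mills mass gap is NOT proved. [folklore] -/
theorem abs_pair_laplace_sub_half_le :
    ∃ K : ℝ, 0 ≤ K ∧ ∀ β : ℝ, 0 < β →
      |β * (∫ q, Real.exp (-(β * ‖su2Quat q.1 * su2Quat q.2 - su2Quat q.2 * su2Quat q.1‖ ^ 2))
          ∂((haarProbability (Matrix.specialUnitaryGroup (Fin 2) ℂ)).prod (haarProbability (Matrix.specialUnitaryGroup (Fin 2) ℂ)))) - 1 / 2| ≤
        K * β ^ (-(11/24 : ℝ)) := by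
  set J := ∫⁻ a, ENNReal.ofReal ((‖(su2Quat a).im‖ ^ 2) ^ (-(1 + (11/24 : ℝ)))) ∂(haarProbability (Matrix.specialUnitaryGroup (Fin 2) ℂ)) with hJ
  have hJtop : J ≠ ∞ := by
    have e : -(1 + (11/24 : ℝ)) = -(35/24 : ℝ) := by norm_num
    rw [hJ, e]
    exact (lintegral_haar_sqNormIm_rpow_lt_top (by norm_num) (by norm_num)).ne
  refine ⟨(4:ℝ) ^ (-(1 + (11/24 : ℝ))) * J.toReal, by positivity, fun β hβ => ?_⟩
  set μ2 := (haarProbability (Matrix.specialUnitaryGroup (Fin 2) ℂ)).prod (haarProbability (Matrix.specialUnitaryGroup (Fin 2) ℂ)) with hμ2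
  have hint : Integrable (fun q : Matrix.specialUnitaryGroup (Fin 2) ℂ × Matrix.specialUnitaryGroup (Fin 2) ℂ =>
      Real.exp (-(β * ‖su2Quat q.1 * su2Quat q.2 - su2Quat q.2 * su2Quat q.1‖ ^ 2))) μ2 := by
    refine Integrable.of_bound (C := 1) ?_ (Filter.Eventually.of_forall fun q => ?_)
    · exact (ENNReal.measurable_toReal.comp (measurable_pairExp β)).aestronglyMeasurable.congr
        (Filter.Eventually.of_forall fun q => by simp [ENNReal.toReal_ofReal (Real.exp_pos _).le])
    · rw [Real.norm_eq_abs, abs_of_pos (Real.exp_pos _)]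
      exact Real.exp_le_one_iff.2 (by nlinarith [sq_nonneg ‖su2Quat q.1 * su2Quat q.2 - su2Quat q.2 * su2Quat q.1‖])
  have hI0 : 0 ≤ ∫ q, Real.exp (-(β * ‖su2Quat q.1 * su2Quat q.2 - su2Quat q.2 * su2Quat q.1‖ ^ 2)) ∂μ2 :=
    integral_nonneg fun q => (Real.exp_pos _).le
  -- the ENNReal deficit bound, converted to reals
  have h := half_le_mul_pairLaplace_add (p := (11/24 : ℝ)) hβ (by norm_num) (by norm_num)
  rw [← hμ2, ← ofReal_integral_eq_lintegral_ofReal hint (Filter.Eventually.of_forall fun q => (Real.exp_pos _).le),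
    ← ENNReal.ofReal_mul hβ.le, ← hJ] at h
  have hfin : ENNReal.ofReal (β ^ (-(11/24 : ℝ)) * (4:ℝ) ^ (-(1 + (11/24 : ℝ)))) * J ≠ ∞ := ENNReal.mul_ne_top ENNReal.ofReal_ne_top hJtop
  have h2 := ENNReal.toReal_mono (ENNReal.add_ne_top.2 ⟨ENNReal.ofReal_ne_top, hfin⟩) h
  rw [ENNReal.toReal_ofReal (by norm_num : (0:ℝ) ≤ 1 / 2), ENNReal.toReal_add ENNReal.ofReal_ne_top hfin,
    ENNReal.toReal_ofReal (mul_nonneg hβ.le hI0), ENNReal.toReal_mul, ENNReal.toReal_ofReal (by positivity)] at h2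
  have hup := pair_laplace_le hβ.le
  rw [← hμ2] at hup
  rw [abs_of_nonpos (by linarith)]
  nlinarith [h2]

end Summit.QuantumFields.YangMills.Theorems.SwapVirialDeficit.ZeroModeExact

end
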